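import Summits.HodgeConjecture.HodgeConjecture.Theses.AmpleAdicLefschetz
import Literature.AlgebraicGeometry.HodgeTheory.ComplexOrientationFamily
import Literature.AlgebraicGeometry.HodgeTheory.SupportedHodgeClassDescent
import Literature.AlgebraicTopology.SingularHomology.GysinMapSupportProofs
import Literature.AlgebraicGeometry.Motives.VarietiesDimensionProofs
import Literature.AlgebraicGeometry.HodgeTheory.RelativeHyperplaneClassHodgeRiemann
import Literature.AlgebraicGeometry.HodgeTheory.HardLefschetzHodgeRiemannHolds
import Literature.AlgebraicGeometry.HodgeTheory.HodgeTypePullback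
import Literature.AlgebraicGeometry.HodgeTheory.AlgebraicClassesHodgeTypeHolds
import Literature.AlgebraicGeometry.HodgeTheory.SupportedClassesRationalProofs
import Literature.AlgebraicGeometry.HodgeTheory.ComplexConjugationHolds
import Summits.HodgeConjecture.HodgeConjecture.Theorems.AmpleAdicLefschetzThickDescentWeakLefschetzSurjective
import Summits.HodgeConjecture.HodgeConjecture.Theorems.AmpleAdicLefschetzThickDescentGysinZeroCup
import Summits.HodgeConjecture.HodgeConjecture.Theorems.AmpleAdicLefschetzThickDescentTransversalAboveMiddle
import Summits.HodgeConjecture.HodgeConjecture.Theorems.AmpleAdicLefschetzThickDescentPrimitiveOfOrthogonal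
import Summits.HodgeConjecture.HodgeConjecture.Theorems.AmpleAdicLefschetzThickDescentAnisotropicKernel
import HarnessLib

/-!
# Route AmpleAdicLefschetz — `ThickDescent` (stmt-HodgeConjecture-2613) REDUCED to Gysin–pull-back
# reflection; the Gysin kernel is transverse to restricted Hodge-span classes in the affine-cover range

Crux `ThickDescent` (THICK): for a closed immersion `f : Y ⟶ X` of smooth projective complex
varieties (`dim X = n`, `dim Y = m`), a finite set `s` of affine opens of `X` covering exactly
`X ∖ f(Y)` with `2p + |s| ≤ n`, every ALGEBRAIC class `c ∈ Nᵖ H²ᵖ(Y(ℂ); ℂ)` in the image of `f^*`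
is `f^* a` for an ALGEBRAIC `a`. This file PROVES (sorry-free, standard axioms) the two sorry-free
halves of the crux line `Cruxes/ThickDescent/Lines/birth.lean` (rev 2) on the tree's real carriers:

* `complexBettiMap_eq_zero_of_complexGysin_eq_zero_of_mem_span` — **GYSIN KERNEL TRANSVERSALITY ON
  THE HODGE SPAN**: in the setting of the crux, for `x ∈ H²ᵖ(X(ℂ); ℂ)` whose restriction `f^* x`
  lies in the `ℂ`-span of the rational `(p,p)`-classes of `Y`, `f_* f^* x = 0 ⇒ f^* x = 0`
  (`f_*` the Gysin morphism of `complexOrientationFamily`). Assembled from the five landed stub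
  theorems of the line: weak Lefschetz SURJECTIVITY in affine-cover form
  (`stub_weakLefschetzSurjective`, Voisin II Thm. 1.23), the Gysin transpose
  (`stub_gysinZero_cup`, Fulton App. B (6)), Poincaré perfectness above the middle
  (`stub_transversal_aboveMiddle`), the Lefschetz reduction to the primitive part
  (`stub_primitive_of_orthogonal`, Voisin I Cor. 6.26) and the anisotropy step
  (`stub_anisotropicKernel`), fed with the Kähler class of `Y` RESTRICTED from a projective
  embedding `Y ⟶ X ⟶ ℙᴺ` (`exists_kaehlerRationalDatum_eq_map`: hard Lefschetz
  `KaehlerRationalDatum.hasHardLefschetzProperty`, sign-free Hodge–Riemann anisotropy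
  `HodgeModel.IsKaehlerClassVia.hodgeRiemann_anisotropy`, Voisin I Thm. 6.25, 6.32, 7.10).
* `thickDescent_of_gysinPullbackReflectsAlgebraic` — **THICK ⇐ REFLECTION**: the crux
  `Theses.AmpleAdicLefschetz.ThickDescent` follows from the X-side statement "an algebraic class of
  the form `f_* f^* x` is `f_* f^* a` with `a` algebraic" (Gysin transport:
  `complexGysin_mem_algebraicClasses`; transversality applied to `a - a₀`, whose restriction
  `f^* a - c` is in the Hodge span because algebraic classes are rational-spanned and of type
  `(p,p)`: `supportedClasses_le_span_isRationalClass`,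
  `isOfHodgeType_of_mem_algebraicClasses_of_isSmoothProjective`, `IsOfHodgeType.map_of_le`).
  The hypothesis is the open, crux-sized heart of the line (sub-middle algebraic-input fragment of
  Grothendieck's `A(X, η)`; implied by the Hodge conjecture for `X` in degree `2p`); it is kept as an
  explicit hypothesis — no named fact, no definition is introduced (D-0026).

## References

* [VoisinHodgeI2002] C. Voisin, Hodge Theory and Complex Algebraic Geometry I (CUP 2002), Thm. 6.25,
  Cor. 6.26, Thm. 6.32, §7.1.2, Thm. 7.10, §7.3.2.
* [VoisinHodgeII2003] C. Voisin, Hodge Theory and Complex Algebraic Geometry II (CUP 2003), Thm. 1.22–1.23.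
* [FultonYoungTableaux1997] W. Fulton, Young Tableaux (CUP 1997), App. B §B.1 (5)–(7).
* [Grothendieck1968] A. Grothendieck, Standard conjectures on algebraic cycles (1968), §3.
* [Voisin2025] C. Voisin, Hodge and generalized Hodge conjectures, coniveau and algebraic cycles
  (2025), §2.1, Cor. 2.12, §4.1 Example 4.2.
* [Hartshorne1977] R. Hartshorne, Algebraic Geometry, I Prop. 1.10, II Ex. 3.20.
-/

noncomputable section

-- mandated namespace `Summit.HodgeConjecture.HodgeConjecture.Theorems` (single-problem summit: Problem =
-- Summit) trips `linter.dupNamespace`; off tree-wide in the lakefile, restated for stand-alone elaboration.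
set_option linter.dupNamespace false

namespace Summit.HodgeConjecture.HodgeConjecture.Theorems

open CategoryTheory AlgebraicGeometry
open Literature.AlgebraicGeometry Literature.AlgebraicGeometry.Motives
open Literature.AlgebraicGeometry.HodgeTheory
open Literature.AlgebraicTopology.SingularHomology
open Literature.Geometry.Kaehler
open Summit.HodgeConjecture.HodgeConjecture.Theses.AmpleAdicLefschetz

/-! ### Book-keeping -/

/-- **`dim Y ≤ dim X` for a closed immersion `Y ⟶ X` of smooth projective varieties**: the topological
Krull dimension is monotone along the closed embedding `Y(Zar) ↪ X(Zar)` and equals `m`, resp. `n`, for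
the smooth irreducible `Y`, resp. `X` (`Motives.topologicalKrullDim_eq_of_smoothOfRelativeDimension`).
[cite: Hartshorne1977, I Prop. 1.10 and II Ex. 3.20] -/
theorem isSmoothProjective_dim_le_of_isClosedImmersion {n m : ℕ} {X Y : SchemeOver ℂ}
    (hX : IsSmoothProjective n X) (hY : IsSmoothProjective m Y) (f : Y ⟶ X) [IsClosedImmersion f.left] :
    m ≤ n := by
  haveI := hX.smoothOfRelativeDimension
  haveI := hY.smoothOfRelativeDimension
  haveI : IrreducibleSpace ↥X.left := irreducibleSpace_of_isSmoothProjective' hX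
  haveI : IrreducibleSpace ↥Y.left := irreducibleSpace_of_isSmoothProjective' hY
  have h1 : topologicalKrullDim Y.left = m :=
    Motives.topologicalKrullDim_eq_of_smoothOfRelativeDimension Y.hom m
  have h2 : topologicalKrullDim X.left = n :=
    Motives.topologicalKrullDim_eq_of_smoothOfRelativeDimension X.hom n
  have h3 : topologicalKrullDim Y.left ≤ topologicalKrullDim X.left :=
    f.left.isClosedEmbedding.isInducing.topologicalKrullDim_le
  rw [h1, h2] at h3
  exact_mod_cast h3

/-- **Algebraic classes lie in the `ℂ`-span of the rational `(p,p)`-classes** (`Z` smooth projective of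
dimension `d`): `Nᵖ H²ᵖ` is spanned by its rational members (`supportedClasses_le_span_isRationalClass`)
and each algebraic class is of Hodge type `(p,p)`
(`isOfHodgeType_of_mem_algebraicClasses_of_isSmoothProjective`). [cite: Deligne2000, §1]
[cite: GrothendieckTopology1969, pp. 299–300] -/
theorem algebraicClasses_le_span_isRationalClass_isOfHodgeType {d : ℕ} {Z : SchemeOver ℂ}
    (hZ : IsSmoothProjective d Z) (p : ℕ) :
    algebraicClasses Z p ≤ Submodule.span ℂ
      {r : complexBetti Z (2 * p) | IsRationalClass r ∧ IsOfHodgeType d Z (2 * p) p p r} := by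
  intro z hz
  have h1 := supportedClasses_le_span_isRationalClass hZ (2 * p) p hz
  refine Submodule.span_mono ?_ h1
  rintro r ⟨hrQ, hrA⟩
  exact ⟨hrQ, isOfHodgeType_of_mem_algebraicClasses_of_isSmoothProjective hZ p hrA⟩

/-- **Pull-back maps the rational-`(p,p)` span of `X` into that of `Y`** for a morphism `f : Y ⟶ X` of
smooth projective varieties with `dim Y ≤ dim X` (`IsRationalClass.map`, `IsOfHodgeType.map_of_le`
with a Hodge model of `Y` from `nonempty_hodgeModel_holds`). [cite: VoisinHodgeI2002, §7.3.2] -/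
theorem map_span_isRationalClass_isOfHodgeType_le {n m : ℕ} {X Y : SchemeOver ℂ}
    (hX : IsSmoothProjective n X) (hY : IsSmoothProjective m Y) (f : Y ⟶ X) (hmn : m ≤ n) (p : ℕ) :
    (Submodule.span ℂ
        {r : complexBetti X (2 * p) | IsRationalClass r ∧ IsOfHodgeType n X (2 * p) p p r}).map
      (complexBetti.map f (2 * p)).hom ≤
    Submodule.span ℂ
      {r : complexBetti Y (2 * p) | IsRationalClass r ∧ IsOfHodgeType m Y (2 * p) p p r} := by
  obtain ⟨B⟩ := (nonempty_hodgeModel_holds (n := m) (X := Y)).nonempty hY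
  refine (Submodule.map_span_le _ _ _).2 ?_
  rintro r ⟨hrQ, hrT⟩
  exact Submodule.subset_span ⟨hrQ.map _, hrT.map_of_le hY hX B f hmn⟩

/-! ### Gysin kernel transversality on the Hodge span -/

/-- **THE GYSIN KERNEL IS TRANSVERSE TO RESTRICTED HODGE-SPAN CLASSES IN THE AFFINE-COVER RANGE.**
Let `f : Y ⟶ X` be a closed immersion of smooth projective complex varieties (`dim X = n`,
`dim Y = m`) whose complement is covered by the affine opens of `s`, `2p + |s| ≤ n`, and let
`x ∈ H²ᵖ(X(ℂ); ℂ)` be a class whose restriction `f^* x` lies in the `ℂ`-span of the RATIONAL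
`(p,p)`-classes of `Y`. If `f_* f^* x = 0` (`f_* : H²ᵖ(Y(ℂ)) → H^{2q}(X(ℂ))` the Gysin morphism of
the complex orientations, `2p + 2n = 2q + 2m`), then `f^* x = 0`. Proof: if `2p > 2m` the carrier is
trivial; else the transpose identity (`stub_gysinZero_cup`) gives `f^* x ∪ f^* y = 0` for all
`y ∈ H^{2m-2p}(X(ℂ))`; above the middle of `Y` the weak Lefschetz surjectivity
(`stub_weakLefschetzSurjective`, degree `2m - 2p ≤ n - |s| - 1`) and Poincaré perfectness
(`stub_transversal_aboveMiddle`) conclude; at or below it, with the Kähler class of `Y` restricted from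
a projective embedding `f ≫ ι` of `X` (`exists_kaehlerRationalDatum_eq_map`; hard Lefschetz
`KaehlerRationalDatum.hasHardLefschetzProperty`; Hodge–Riemann anisotropy
`HodgeModel.IsKaehlerClassVia.hodgeRiemann_anisotropy`), the Lefschetz reduction
(`stub_primitive_of_orthogonal`, surjectivity in degrees `≤ 2p - 2`) makes `f^* x` primitive and the
anisotropy step (`stub_anisotropicKernel`) kills it.
[cite: VoisinHodgeI2002, Thm. 6.25, Cor. 6.26, Thm. 6.32 and Thm. 7.10]
[cite: VoisinHodgeII2003, Thm. 1.23] [cite: FultonYoungTableaux1997, Appendix B §B.1 (6)] -/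
theorem complexBettiMap_eq_zero_of_complexGysin_eq_zero_of_mem_span :
    ∀ ⦃n m p q : ℕ⦄ ⦃X Y : SchemeOver ℂ⦄ (f : Y ⟶ X) (hX : IsSmoothProjective n X)
      (hY : IsSmoothProjective m Y), IsClosedImmersion f.left →
      ∀ (s : Finset X.left.Opens), (∀ U ∈ s, IsAffineOpen U) →
      (⋃ U ∈ s, (U : Set X.left)) = (Set.range f.left.base)ᶜ → 2 * p + s.card ≤ n →
      ∀ (hpq : 2 * p + 2 * n = 2 * q + 2 * m) (x : complexBetti X (2 * p)),
      complexBetti.map f (2 * p) x ∈ Submodule.span ℂ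
        {r : complexBetti Y (2 * p) | IsRationalClass r ∧ IsOfHodgeType m Y (2 * p) p p r} →
      complexGysin complexOrientationFamily hY hX f hpq (complexBetti.map f (2 * p) x) = 0 →
      complexBetti.map f (2 * p) x = 0 := by
  intro n m p q X Y f hX hY hf s hs hcov hle hpq x hspan hzero
  -- degenerate range: above the real dimension of `Y(ℂ)` the carrier is trivial
  by_cases hpm : 2 * m < 2 * p
  · haveI := subsingleton_complexBetti hY hpm
    exact Subsingleton.elim _ _
  -- transpose: `f^* x ⊥ f^* H^{2m-2p}(X)`
  have hk : 2 * p + (2 * m - 2 * p) = 2 * m := by omega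
  have horth : ∀ y : complexBetti X (2 * m - 2 * p),
      cupProduct hk (complexBetti.map f (2 * p) x) (complexBetti.map f (2 * m - 2 * p) y) = 0 :=
    stub_gysinZero_cup f hX hY hpq hk (complexBetti.map f (2 * p) x) hzero
  -- weak Lefschetz surjectivity in the affine-cover range
  have hsurj : ∀ i : ℕ, i + s.card + 1 ≤ n → Function.Surjective (complexBetti.map f i) :=
    fun i hi ↦ stub_weakLefschetzSurjective f hX hf s hs hcov i hi
  rcases Nat.lt_or_ge m (2 * p) with hlt | hge
  · -- above the middle of `Y`: Poincaré duality alone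
    exact stub_transversal_aboveMiddle f hY hk x (hsurj _ (by omega)) horth
  · -- at or below the middle of `Y`: `m = 2p + s'`
    obtain ⟨s', hs'⟩ : ∃ s' : ℕ, 2 * p + s' = m := ⟨m - 2 * p, by omega⟩
    -- the Kähler class of `Y` restricted from a projective embedding `Y ⟶ X ⟶ ℙᴺ`
    obtain ⟨N, ι, hι⟩ := hX.isProjectiveOver
    haveI := hι
    haveI : IsClosedImmersion (f ≫ ι).left := by
      rw [Over.comp_left]
      infer_instance
    obtain ⟨D, c₀, hD⟩ := exists_kaehlerRationalDatum_eq_map hY (f ≫ ι)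
    have hfκ : complexBetti.map f 2 (complexBetti.map ι 2 c₀) = D.Hη := by
      rw [hD, complexBetti.map_comp]
      rfl
    obtain ⟨κ, hκ⟩ : ∃ κ : complexBetti X 2, complexBetti.map f 2 κ = D.Hη := ⟨_, hfκ⟩
    have hHL : HasHardLefschetzProperty (complexBetti.map f 2 κ) m := by
      rw [hκ]
      exact D.hasHardLefschetzProperty hY
    have hrat : IsRationalClass (complexBetti.map f 2 κ) := by
      rw [hκ]
      exact D.isRationalClass_Hη
    have hHR : ∀ y : complexBetti Y (2 * p), IsRationalClass y → IsOfHodgeType m Y (2 * p) p p y →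
        lefschetzPowTo (complexBetti.map f 2 κ) (s' + 1) (2 * p) (2 * p + 2 * (s' + 1)) rfl y = 0 →
        y ≠ 0 →
        cupProduct (show 2 * p + 2 * s' + 2 * p = 2 * m by omega)
          (lefschetzPowTo (complexBetti.map f 2 κ) s' (2 * p) (2 * p + 2 * s') rfl y) y ≠ 0 := by
      rw [hκ]
      intro y hyQ hyT hprim hy0
      exact D.isKaehlerClassVia.hodgeRiemann_anisotropy D.B D.isNatural D.isMultiplicative hY p s' hs'
        y hyQ hyT hprim hy0
    -- the Lefschetz reduction: `f^* x` is primitive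
    have hprim := stub_primitive_of_orthogonal f hY hs' hk κ hHL (fun i hi ↦ hsurj i (by omega)) x horth
    -- the anisotropy step
    exact stub_anisotropicKernel f hX hY hs' hk κ hrat hHR x hspan hprim horth

/-! ### THICK from reflection -/

/-- **`ThickDescent` ⇐ GYSIN–PULL-BACK REFLECTION.** If for every morphism `f : Y ⟶ X` of smooth
projective complex varieties every ALGEBRAIC class of `X` of the form `f_* f^* x`
(`2p + 2 dim X = 2q + 2 dim Y`) is `f_* f^* a` with `a` ALGEBRAIC of codimension `p`, then the crux
`Theses.AmpleAdicLefschetz.ThickDescent` holds. Proof (Gysin transport): for `c = f^* a₀ ∈ Alg^p(Y)`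
in the crux setting, if `2p > 2m` then `c = 0` and `a = 0` serves; else `f_* c ∈ Alg^q(X)`
(`complexGysin_mem_algebraicClasses`, `q = p + n - m` by
`isSmoothProjective_dim_le_of_isClosedImmersion`), reflection gives `a ∈ Alg^p(X)` with
`f_* f^*(a - a₀) = 0`, the restriction `f^*(a - a₀) = f^* a - c` lies in the rational-`(p,p)` span
(`algebraicClasses_le_span_isRationalClass_isOfHodgeType`,
`map_span_isRationalClass_isOfHodgeType_le`), and
`complexBettiMap_eq_zero_of_complexGysin_eq_zero_of_mem_span` gives `f^* a = c`. The hypothesis is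
the open X-side heart of the line (for `Y` a complete intersection of members of the polarising
system it is the sub-middle algebraic-input fragment of Grothendieck's `A(X, η)`; it follows from the
Hodge conjecture for `X` in degree `2p` by the semisimple lift through `f_* ∘ f^*`).
[cite: Voisin2025, §2.1, Cor. 2.12 and §4.1 Example 4.2] [cite: Grothendieck1968, §3 p. 196]
[cite: FultonYoungTableaux1997, Appendix B §B.1 (5)–(7)] -/
theorem thickDescent_of_gysinPullbackReflectsAlgebraic :
    (∀ ⦃n m p q : ℕ⦄ ⦃X Y : SchemeOver ℂ⦄ (f : Y ⟶ X) (hX : IsSmoothProjective n X)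
      (hY : IsSmoothProjective m Y) (hpq : 2 * p + 2 * n = 2 * q + 2 * m) (x : complexBetti X (2 * p)),
      complexGysin complexOrientationFamily hY hX f hpq (complexBetti.map f (2 * p) x) ∈
          algebraicClasses X q →
        ∃ a ∈ algebraicClasses X p,
          complexGysin complexOrientationFamily hY hX f hpq (complexBetti.map f (2 * p) a) =
            complexGysin complexOrientationFamily hY hX f hpq (complexBetti.map f (2 * p) x)) →
    ThickDescent := by
  intro hR n m p X Y f hX hY hf s hs hcov hle c hc hcr
  haveI : IsClosedImmersion f.left := hf
  have hmn : m ≤ n := isSmoothProjective_dim_le_of_isClosedImmersion hX hY f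
  -- degenerate range: above the real dimension of `Y(ℂ)` the carrier is trivial and `a = 0` serves
  by_cases hpm : 2 * m < 2 * p
  · haveI := subsingleton_complexBetti hY hpm
    exact ⟨0, Submodule.zero_mem _, Subsingleton.elim _ _⟩
  -- the Gysin degree `2q = 2p + 2(n - m)`
  have hpq : 2 * p + 2 * n = 2 * (p + n - m) + 2 * m := by omega
  -- `c = f^* a₀`
  obtain ⟨a₀, rfl⟩ := LinearMap.mem_range.1 hcr
  -- transport: `f_* c` is algebraic on `X`
  have hGc : complexGysin complexOrientationFamily hY hX f hpq ((complexBetti.map f (2 * p)).hom a₀) ∈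
      algebraicClasses X (p + n - m) :=
    complexGysin_mem_algebraicClasses (gysinMap_restrictCompl_eq_zero_of_field ℂ)
      complexOrientationFamily hasPoincareDuality_complexOrientationFamily hY hX f (by omega) hpq hc
  -- reflection: an algebraic `a` with `f_* f^* a = f_* f^* a₀`
  obtain ⟨a, ha, hGa⟩ := hR f hX hY hpq a₀ hGc
  refine ⟨a, ha, ?_⟩
  -- the difference `x = a - a₀` has `f_* f^* x = 0` and restriction in the rational-`(p,p)` span
  have hzero : complexGysin complexOrientationFamily hY hX f hpq (complexBetti.map f (2 * p) (a - a₀)) = 0 := by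
    rw [map_sub, map_sub, hGa, sub_self]
  have hspan : complexBetti.map f (2 * p) (a - a₀) ∈ Submodule.span ℂ
      {r : complexBetti Y (2 * p) | IsRationalClass r ∧ IsOfHodgeType m Y (2 * p) p p r} := by
    rw [map_sub]
    refine Submodule.sub_mem _ ?_ (algebraicClasses_le_span_isRationalClass_isOfHodgeType hY p hc)
    exact map_span_isRationalClass_isOfHodgeType_le hX hY f hmn p
      (Submodule.mem_map_of_mem (algebraicClasses_le_span_isRationalClass_isOfHodgeType hX p ha))
  have hfx := complexBettiMap_eq_zero_of_complexGysin_eq_zero_of_mem_span f hX hY hf s hs hcov hle hpq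
    (a - a₀) hspan hzero
  rw [map_sub, sub_eq_zero] at hfx
  exact hfx

/-! ### THICK at a given section from reflection AT THAT SECTION -/

/-- **`ThickDescent` at a given `(f, p)` from reflection at the same `(f, p)`** (pointwise form of
`thickDescent_of_gysinPullbackReflectsAlgebraic`): for a closed immersion `f : Y ⟶ X` of smooth
projective complex varieties whose complement is covered by the affine opens of `s`, `2p + |s| ≤ dim X`,
if every algebraic class of `X` of the form `f_* f^* x`, `x ∈ H²ᵖ(X(ℂ); ℂ)` (any Gysin degree `q`
with `2p + 2 dim X = 2q + 2 dim Y`), is `f_* f^* a` with `a ∈ Alg^p(X)`, then every algebraic class of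
`Y` in the image of `f^*` on `H²ᵖ` is the restriction of an algebraic class of `X`. So the open
reflection statement is needed only for the closed immersions of the crux (where `f_* f^* = (· ∪ [Y])`,
`[Y] = f_* 1_Y`), not for arbitrary morphisms. Same proof: Gysin transport
(`complexGysin_mem_algebraicClasses`), reflection at `f`, and the transversality theorem
`complexBettiMap_eq_zero_of_complexGysin_eq_zero_of_mem_span` applied to `a - a₀`.
[cite: Voisin2025, §2.1, Cor. 2.12 and §4.1 Example 4.2] [cite: FultonYoungTableaux1997, Appendix B §B.1 (5)–(7)] -/
theorem exists_mem_algebraicClasses_map_eq_of_reflectsAt :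
    ∀ ⦃n m p : ℕ⦄ ⦃X Y : SchemeOver ℂ⦄ (f : Y ⟶ X) (hX : IsSmoothProjective n X)
      (hY : IsSmoothProjective m Y), IsClosedImmersion f.left →
      ∀ (s : Finset X.left.Opens), (∀ U ∈ s, IsAffineOpen U) →
      (⋃ U ∈ s, (U : Set X.left)) = (Set.range f.left.base)ᶜ → 2 * p + s.card ≤ n →
      (∀ (q : ℕ) (hpq : 2 * p + 2 * n = 2 * q + 2 * m) (x : complexBetti X (2 * p)),
        complexGysin complexOrientationFamily hY hX f hpq (complexBetti.map f (2 * p) x) ∈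
            algebraicClasses X q →
          ∃ a ∈ algebraicClasses X p,
            complexGysin complexOrientationFamily hY hX f hpq (complexBetti.map f (2 * p) a) =
              complexGysin complexOrientationFamily hY hX f hpq (complexBetti.map f (2 * p) x)) →
      ∀ c ∈ algebraicClasses Y p, c ∈ LinearMap.range (complexBetti.map f (2 * p)).hom →
      ∃ a ∈ algebraicClasses X p, complexBetti.map f (2 * p) a = c := by
  intro n m p X Y f hX hY hf s hs hcov hle hR c hc hcr
  haveI : IsClosedImmersion f.left := hf
  have hmn : m ≤ n := isSmoothProjective_dim_le_of_isClosedImmersion hX hY f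
  -- degenerate range: above the real dimension of `Y(ℂ)` the carrier is trivial and `a = 0` serves
  by_cases hpm : 2 * m < 2 * p
  · haveI := subsingleton_complexBetti hY hpm
    exact ⟨0, Submodule.zero_mem _, Subsingleton.elim _ _⟩
  -- the Gysin degree `2q = 2p + 2(n - m)`
  have hpq : 2 * p + 2 * n = 2 * (p + n - m) + 2 * m := by omega
  -- `c = f^* a₀`
  obtain ⟨a₀, rfl⟩ := LinearMap.mem_range.1 hcr
  -- transport: `f_* c` is algebraic on `X`
  have hGc : complexGysin complexOrientationFamily hY hX f hpq ((complexBetti.map f (2 * p)).hom a₀) ∈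
      algebraicClasses X (p + n - m) :=
    complexGysin_mem_algebraicClasses (gysinMap_restrictCompl_eq_zero_of_field ℂ)
      complexOrientationFamily hasPoincareDuality_complexOrientationFamily hY hX f (by omega) hpq hc
  -- reflection at `f`: an algebraic `a` with `f_* f^* a = f_* f^* a₀`
  obtain ⟨a, ha, hGa⟩ := hR (p + n - m) hpq a₀ hGc
  refine ⟨a, ha, ?_⟩
  have hzero : complexGysin complexOrientationFamily hY hX f hpq (complexBetti.map f (2 * p) (a - a₀)) = 0 := by
    rw [map_sub, map_sub, hGa, sub_self]
  have hspan : complexBetti.map f (2 * p) (a - a₀) ∈ Submodule.span ℂ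
      {r : complexBetti Y (2 * p) | IsRationalClass r ∧ IsOfHodgeType m Y (2 * p) p p r} := by
    rw [map_sub]
    refine Submodule.sub_mem _ ?_ (algebraicClasses_le_span_isRationalClass_isOfHodgeType hY p hc)
    exact map_span_isRationalClass_isOfHodgeType_le hX hY f hmn p
      (Submodule.mem_map_of_mem (algebraicClasses_le_span_isRationalClass_isOfHodgeType hX p ha))
  have hfx := complexBettiMap_eq_zero_of_complexGysin_eq_zero_of_mem_span f hX hY hf s hs hcov hle hpq
    (a - a₀) hspan hzero
  rw [map_sub, sub_eq_zero] at hfx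
  exact hfx

end Summit.HodgeConjecture.HodgeConjecture.Theorems

end
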